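import Summits.QuantumFields.BalabanUV.T4Continuum.Support.B13HistDatum

/-!
# B13HistMeasurable — row O1-c (HISTORY ∕ TABLES) of the NE5 crux O1, part 3: the CLOSED SUBSPACE of potential tables that are
# MEASURABLE in the field argument — the `Hist` on which the exp-linear structure `TermHistExpLinear` can be instantiated
# (cell `pub-balaban`, T⁴ fan-out, `HOME/t4/b2b-balaban-t4-ne5-p1/O1-CLAIM-TABLE-NE5-P1.md` row O1-c; design `B13StepDesign.md` v0.2 R3)

Unit `b2b-balaban-t4-ne5-formalise-leaf-06` (NE5 formalisation swarm, leaf prover 06).  Summits-side NEW WORK under the LEAN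
PLACEMENT RULE (cell modelling + bookkeeping; NOT a Literature module; nothing of the manuscripts under audit is asserted).  HONEST
FRAMING: rung (B)+1 of the FINITE-VOLUME T⁴ continuum programme — NOT infinite volume, NOT a mass gap, NOT the Clay problem, NOT a
proof of NE5 (NOT PRINTED; cell GAPS G-t4-U3-1).  HONEST DEPENDENCY (cell line, verbatim): continuum YM on T⁴ ⇐ BetaPertH ∧ nine
spine estimates (0/9 proved); BetaPertH ⇐ (D1) ∧ (D4) ∧ CAP+tail; G-an2-4 gates asym, D1 and NE2/3/4.

WHY THIS FILE (a typing obstruction removed, no estimate).  Part 1 (`B13HistDatum`) types `B13Hist P` = ALL bounded potential tables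
on the entries `V″(Y, φ)`, `Q(Y, φ, b, b′)`.  The structural route to the history half of wall W2 (`T4InputCauchyRateTermwise.
TermHistExpLinear`, record `t4/T4-EST-NE5-P1.md` §33; the swarm's O1-d2 socket `B13StepTermFamily.ActExpLinearOn`) writes a term as
`∫ Φ(a)·cexp(Λ(a) h) dμ(a)` with `Λ(a) h = Σ_Y τ(Y)·𝐕_k(Y, B(a))` and REQUIRES, for EVERY `h : Hist`, the weak measurability
`AEStronglyMeasurable (fun a ↦ Λ a h) μ` — which FAILS on `B13Hist P` as soon as the field `B(a)` ranges over a continuum, because a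
bounded table need not be measurable in `φ`.  The honest history space for that route is therefore the subspace of tables whose
entries are MEASURABLE functions of the argument (Bałaban's potentials are analytic in `B` on (1.34), [II] Lemma 2 p. 11 — a
fortiori measurable; nothing is lost).  Typed here:
* §1 `MeasPotFrame C` (a `PotFrame` + a measurable structure on every `Arg Y` with the bond variables `Bv Y · b` measurable),
  `IsMeasTable`, the submodule `measTables P` and the space `B13HistM P := ↥(measTables P)`; **`isClosed_measTables`** (pointwise
  limits of measurable functions — `measurable_of_tendsto_metrizable`), hence `CompleteSpace (B13HistM P)` (a Banach space, as the
  END faces' Cauchy estimates in the insertion operators require, `OutputRateInsertion` §2);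
* §2 the read-outs `VppM ∕ QkerM ∕ potM` and their CLMs on the subspace (restrictions of part 1's by `Submodule.subtypeL`), the norm
  bounds with the SAME weights, the dictionary `norm_le_iff` transported, and the constructor `ofMeasPotentials` (measurable `V″`, `Q`
  obeying (1.36)∕(1.43) with the factor `μ` ↦ a measurable table of norm `≤ μ`);
* §3 **`measurable_potM`** (`φ ↦ 𝐕(Y, φ)` is measurable for every measurable table) and **`aestronglyMeasurable_potCLMM_comp`**: for a
  measurable field map `B : α → Arg Y`, `a ↦ potCLMM Y (B a) h` is a.e.-strongly measurable for EVERY `h` — exactly the weak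
  measurability clause of `TermHistExpLinear` ∕ `ActExpLinearOn` for functionals assembled from these read-outs (`Λ(a) = Σ_Y τ(Y) •
  potCLMM Y (B_Y a)`: `aestronglyMeasurable_sum_smul_potCLMM`).
WHAT IS NOT HERE: no estimate of [II]; no term family, no measure space of (2.14) (row O1-d2); no claim that Bałaban's potentials are
in any ball (quoted leaf, trigger rule c4).  0 sorry; axioms ⊆ {propext, Classical.choice, Quot.sound}.
-/

noncomputable section

open scoped BigOperators
open Finset MeasureTheory Filter Topology

namespace Summit.QuantumFields.BalabanUV.T4Continuum.B13HistMeasurable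

open Literature.MathematicalPhysics.QuantumFieldTheory.Balaban1983to89
open Literature.MathematicalPhysics.QuantumFieldTheory.Balaban1983to89.T4OutputRate (Carriers)
open Summit.QuantumFields.BalabanUV.T4Continuum.B13HistDatum

variable {C : Carriers}

/-! ## §1 The measurable potential frame and the closed subspace of measurable tables -/

/-- [folklore] DATA (no inequality inside): a potential frame whose argument types carry measurable structures in which the bond
variables are measurable (e.g. the Borel structure of the rescaled small-field polydisc; the instancer's choice). -/
structure MeasPotFrame (C : Carriers) extends PotFrame C where
  /-- measurable structure on the arguments at `Y` -/
  meas : ∀ Y, MeasurableSpace (Arg Y)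
  /-- the bond variables are measurable in the argument -/
  measurable_Bv : ∀ (Y : C.Dom) (b : Bond Y), @Measurable _ _ (meas Y) _ fun φ => Bv Y φ b

/-- [folklore] The frame's measurable structure on `Arg Y`, registered as an instance (the frame's own datum). -/
instance MeasPotFrame.instMeasurableSpaceArg (P : MeasPotFrame C) (Y : C.Dom) : MeasurableSpace (P.Arg Y) := P.meas Y

namespace MeasPotFrame

variable (P : MeasPotFrame C)

/-- [folklore] The bond variables are measurable (instance form of the frame's datum). -/
theorem measurable_Bv' (Y : C.Dom) (b : P.Bond Y) : Measurable fun φ => P.Bv Y φ b := P.measurable_Bv Y b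

/-- [folklore] Entrywise additivity of `V″` (the read-out is linear). -/
theorem Vpp_add (h h' : B13Hist P.toPotFrame) (Y : C.Dom) (φ : P.Arg Y) :
    P.Vpp (h + h') Y φ = P.Vpp h Y φ + P.Vpp h' Y φ := by
  simp only [PotFrame.Vpp, ← HistFrame.readCLM_apply, map_add]

/-- [folklore] Entrywise additivity of `Q`. -/
theorem Qker_add (h h' : B13Hist P.toPotFrame) (Y : C.Dom) (φ : P.Arg Y) (b b' : P.Bond Y) :
    P.Qker (h + h') Y φ b b' = P.Qker h Y φ b b' + P.Qker h' Y φ b b' := by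
  simp only [PotFrame.Qker, ← HistFrame.readCLM_apply, map_add]

/-- [folklore] Entrywise homogeneity of `V″`. -/
theorem Vpp_smul (z : ℂ) (h : B13Hist P.toPotFrame) (Y : C.Dom) (φ : P.Arg Y) :
    P.Vpp (z • h) Y φ = z * P.Vpp h Y φ := by
  simp only [PotFrame.Vpp, ← HistFrame.readCLM_apply, map_smul, smul_eq_mul]

/-- [folklore] Entrywise homogeneity of `Q`. -/
theorem Qker_smul (z : ℂ) (h : B13Hist P.toPotFrame) (Y : C.Dom) (φ : P.Arg Y) (b b' : P.Bond Y) :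
    P.Qker (z • h) Y φ b b' = z * P.Qker h Y φ b b' := by
  simp only [PotFrame.Qker, ← HistFrame.readCLM_apply, map_smul, smul_eq_mul]

/-- [folklore] The zero table has zero entries. -/
theorem Vpp_zero (Y : C.Dom) (φ : P.Arg Y) : P.Vpp 0 Y φ = 0 := by
  simp only [PotFrame.Vpp, ← HistFrame.readCLM_apply, map_zero]

/-- [folklore] The zero table has zero kernel entries. -/
theorem Qker_zero (Y : C.Dom) (φ : P.Arg Y) (b b' : P.Bond Y) : P.Qker 0 Y φ b b' = 0 := by
  simp only [PotFrame.Qker, ← HistFrame.readCLM_apply, map_zero]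

/-- [folklore] A table is MEASURABLE if every entry family `φ ↦ V″(Y, φ)`, `φ ↦ Q(Y, φ, b, b′)` is a measurable function of the
argument. -/
def IsMeasTable (h : B13Hist P.toPotFrame) : Prop :=
  (∀ Y, Measurable fun φ => P.Vpp h Y φ) ∧ ∀ (Y : C.Dom) (b b' : P.Bond Y), Measurable fun φ => P.Qker h Y φ b b'

/-- [folklore] The measurable tables form a ℂ-submodule of `B13Hist P` (read-outs are linear). -/
def measTables : Submodule ℂ (B13Hist P.toPotFrame) where
  carrier := {h | P.IsMeasTable h}
  add_mem' := by
    rintro h h' ⟨hV, hQ⟩ ⟨hV', hQ'⟩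
    refine ⟨fun Y => ?_, fun Y b b' => ?_⟩
    · have e : (fun φ => P.Vpp (h + h') Y φ) = (fun φ => P.Vpp h Y φ) + fun φ => P.Vpp h' Y φ :=
        funext fun φ => P.Vpp_add h h' Y φ
      rw [e]; exact (hV Y).add (hV' Y)
    · have e : (fun φ => P.Qker (h + h') Y φ b b') = (fun φ => P.Qker h Y φ b b') + fun φ => P.Qker h' Y φ b b' :=
        funext fun φ => P.Qker_add h h' Y φ b b'
      rw [e]; exact (hQ Y b b').add (hQ' Y b b')
  zero_mem' := by
    refine ⟨fun Y => ?_, fun Y b b' => ?_⟩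
    · have e : (fun φ => P.Vpp 0 Y φ) = fun _ => 0 := funext fun φ => P.Vpp_zero Y φ
      rw [e]; exact measurable_const
    · have e : (fun φ => P.Qker 0 Y φ b b') = fun _ => 0 := funext fun φ => P.Qker_zero Y φ b b'
      rw [e]; exact measurable_const
  smul_mem' := by
    rintro z h ⟨hV, hQ⟩
    refine ⟨fun Y => ?_, fun Y b b' => ?_⟩
    · have e : (fun φ => P.Vpp (z • h) Y φ) = fun φ => z * P.Vpp h Y φ := funext fun φ => P.Vpp_smul z h Y φ
      rw [e]; exact (hV Y).const_mul z
    · have e : (fun φ => P.Qker (z • h) Y φ b b') = fun φ => z * P.Qker h Y φ b b' :=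
        funext fun φ => P.Qker_smul z h Y φ b b'
      rw [e]; exact (hQ Y b b').const_mul z

/-- [folklore] Membership in the submodule is measurability of the table. -/
theorem mem_measTables {h : B13Hist P.toPotFrame} : h ∈ P.measTables ↔ P.IsMeasTable h := Iff.rfl

/-- [folklore] **The measurable tables are CLOSED** in `B13Hist P`: a norm limit of tables converges entrywise (the read-outs are
bounded functionals), and a pointwise limit of measurable functions is measurable. -/
theorem isClosed_measTables : IsClosed (P.measTables : Set (B13Hist P.toPotFrame)) := by
  refine IsSeqClosed.isClosed fun u h hu hlim => ?_
  have hread : ∀ i : PotIdx P.toPotFrame, Tendsto (fun n => P.frame.read (u n) i) atTop (𝓝 (P.frame.read h i)) := fun i => by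
    have hc : Continuous fun x : B13Hist P.toPotFrame => P.frame.readCLM i x := (P.frame.readCLM i).continuous
    have ht := (hc.tendsto h).comp hlim
    simpa only [Function.comp_def, HistFrame.readCLM_apply] using ht
  refine ⟨fun Y => ?_, fun Y b b' => ?_⟩
  · refine measurable_of_tendsto_metrizable (f := fun n φ => P.Vpp (u n) Y φ) (fun n => (hu n).1 Y) ?_
    exact tendsto_pi_nhds.2 fun φ => hread (.rem Y φ)
  · refine measurable_of_tendsto_metrizable (f := fun n φ => P.Qker (u n) Y φ b b') (fun n => (hu n).2 Y b b') ?_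
    exact tendsto_pi_nhds.2 fun φ => hread (.ker Y φ b b')

end MeasPotFrame

/-- [folklore] THE MEASURABLE HISTORY SPACE OF ROW O1-c: the closed subspace of measurable potential tables (a Banach space). -/
abbrev B13HistM (P : MeasPotFrame C) : Type := ↥P.measTables

/-- [folklore] Completeness of the measurable history space (closed subspace of a complete space). -/
instance (P : MeasPotFrame C) : CompleteSpace (B13HistM P) := P.isClosed_measTables.completeSpace_coe

namespace MeasPotFrame

variable (P : MeasPotFrame C)

/-! ## §2 Read-outs, norm bounds, dictionary and constructor on the subspace -/

/-- [folklore] `V″(Y, φ)` of a measurable table. -/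
def VppM (h : B13HistM P) (Y : C.Dom) (φ : P.Arg Y) : ℂ := P.Vpp h.1 Y φ

/-- [folklore] `Q(Y, φ, b, b′)` of a measurable table. -/
def QkerM (h : B13HistM P) (Y : C.Dom) (φ : P.Arg Y) (b b' : P.Bond Y) : ℂ := P.Qker h.1 Y φ b b'

/-- [folklore] The potential value `𝐕(Y, φ)` ((1.42)) of a measurable table. -/
def potM (h : B13HistM P) (Y : C.Dom) (φ : P.Arg Y) : ℂ := P.pot h.1 Y φ

/-- [folklore] The potential value as a bounded linear functional on the measurable history space. -/
def potCLMM (Y : C.Dom) (φ : P.Arg Y) : B13HistM P →L[ℂ] ℂ := (P.potCLM Y φ).comp P.measTables.subtypeL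

/-- [folklore] `potCLMM` evaluates to `potM`. -/
@[simp] theorem potCLMM_apply (Y : C.Dom) (φ : P.Arg Y) (h : B13HistM P) : P.potCLMM Y φ h = P.potM h Y φ := by
  simp [potCLMM, potM]

/-- [folklore] `‖potCLMM Y φ‖ ≤ potWt Y φ` (the subspace carries the restricted norm). -/
theorem norm_potCLMM_le (Y : C.Dom) (φ : P.Arg Y) : ‖P.potCLMM Y φ‖ ≤ P.potWt Y φ :=
  (ContinuousLinearMap.opNorm_comp_le _ _).trans <| by
    have h1 := P.measTables.norm_subtypeL_le
    have h0 : 0 ≤ P.potWt Y φ := (norm_nonneg _).trans (P.norm_potCLM_le Y φ)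
    calc ‖P.potCLM Y φ‖ * ‖P.measTables.subtypeL‖ ≤ P.potWt Y φ * 1 :=
          mul_le_mul (P.norm_potCLM_le Y φ) h1 (norm_nonneg P.measTables.subtypeL) h0
      _ = P.potWt Y φ := mul_one _

/-- [folklore] `‖V″(Y, φ)‖ ≤ (1.36)-format × ‖h‖` on the subspace. -/
theorem norm_VppM_le (h : B13HistM P) (Y : C.Dom) (φ : P.Arg Y) :
    ‖P.VppM h Y φ‖ ≤ level136 P.consts (C.d Y) * ‖h‖ := by
  rw [Submodule.coe_norm]; exact P.norm_Vpp_le h.1 Y φ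

/-- [folklore] `‖Q(Y, φ, b, b′)‖ ≤ (1.43)-format × ‖h‖` on the subspace. -/
theorem norm_QkerM_le (h : B13HistM P) (Y : C.Dom) (φ : P.Arg Y) (b b' : P.Bond Y) :
    ‖P.QkerM h Y φ b b'‖ ≤ level143 P.consts (C.d Y) (P.vol Y) * ‖h‖ := by
  rw [Submodule.coe_norm]; exact P.norm_Qker_le h.1 Y φ b b'

/-- [folklore] THE DICTIONARY on the subspace: `‖h‖ ≤ μ` iff (1.36) and (1.43) hold with the factor `μ` (`μ ≥ 0`). -/
theorem norm_le_iff (h : B13HistM P) {μ : ℝ} (hμ : 0 ≤ μ) :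
    ‖h‖ ≤ μ ↔ (∀ Y φ, ‖P.VppM h Y φ‖ ≤ μ * level136 P.consts (C.d Y)) ∧
      ∀ Y φ b b', ‖P.QkerM h Y φ b b'‖ ≤ μ * level143 P.consts (C.d Y) (P.vol Y) := by
  rw [Submodule.coe_norm]; exact P.toPotFrame.norm_le_iff h.1 hμ

/-- [folklore] CONSTRUCTOR: MEASURABLE potentials `V″`, `Q` obeying (1.36) ∕ (1.43) with the factor `μ` give a measurable table. -/
def ofMeasPotentials (V : (Y : C.Dom) → P.Arg Y → ℂ) (Q : (Y : C.Dom) → P.Arg Y → P.Bond Y → P.Bond Y → ℂ) (μ : ℝ)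
    (hV : ∀ Y φ, ‖V Y φ‖ ≤ μ * level136 P.consts (C.d Y))
    (hQ : ∀ Y φ b b', ‖Q Y φ b b'‖ ≤ μ * level143 P.consts (C.d Y) (P.vol Y))
    (mV : ∀ Y, Measurable (V Y)) (mQ : ∀ Y b b', Measurable fun φ => Q Y φ b b') : B13HistM P :=
  ⟨P.ofPotentials V Q μ hV hQ, by
    refine ⟨fun Y => ?_, fun Y b b' => ?_⟩
    · simpa only [PotFrame.Vpp_ofPotentials] using mV Y
    · simpa only [PotFrame.Qker_ofPotentials] using mQ Y b b'⟩

/-- [folklore] The constructor reproduces `V″`. -/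
@[simp] theorem VppM_ofMeasPotentials (V : (Y : C.Dom) → P.Arg Y → ℂ)
    (Q : (Y : C.Dom) → P.Arg Y → P.Bond Y → P.Bond Y → ℂ) (μ : ℝ)
    (hV : ∀ Y φ, ‖V Y φ‖ ≤ μ * level136 P.consts (C.d Y))
    (hQ : ∀ Y φ b b', ‖Q Y φ b b'‖ ≤ μ * level143 P.consts (C.d Y) (P.vol Y))
    (mV : ∀ Y, Measurable (V Y)) (mQ : ∀ Y b b', Measurable fun φ => Q Y φ b b') (Y : C.Dom) (φ : P.Arg Y) :
    P.VppM (P.ofMeasPotentials V Q μ hV hQ mV mQ) Y φ = V Y φ :=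
  P.Vpp_ofPotentials V Q μ hV hQ Y φ

/-- [folklore] The constructor reproduces `Q`. -/
@[simp] theorem QkerM_ofMeasPotentials (V : (Y : C.Dom) → P.Arg Y → ℂ)
    (Q : (Y : C.Dom) → P.Arg Y → P.Bond Y → P.Bond Y → ℂ) (μ : ℝ)
    (hV : ∀ Y φ, ‖V Y φ‖ ≤ μ * level136 P.consts (C.d Y))
    (hQ : ∀ Y φ b b', ‖Q Y φ b b'‖ ≤ μ * level143 P.consts (C.d Y) (P.vol Y))
    (mV : ∀ Y, Measurable (V Y)) (mQ : ∀ Y b b', Measurable fun φ => Q Y φ b b') (Y : C.Dom) (φ : P.Arg Y)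
    (b b' : P.Bond Y) : P.QkerM (P.ofMeasPotentials V Q μ hV hQ mV mQ) Y φ b b' = Q Y φ b b' :=
  P.Qker_ofPotentials V Q μ hV hQ Y φ b b'

/-- [folklore] … and yields a table of norm at most `μ`. -/
theorem norm_ofMeasPotentials_le (V : (Y : C.Dom) → P.Arg Y → ℂ)
    (Q : (Y : C.Dom) → P.Arg Y → P.Bond Y → P.Bond Y → ℂ) {μ : ℝ} (hμ : 0 ≤ μ)
    (hV : ∀ Y φ, ‖V Y φ‖ ≤ μ * level136 P.consts (C.d Y))
    (hQ : ∀ Y φ b b', ‖Q Y φ b b'‖ ≤ μ * level143 P.consts (C.d Y) (P.vol Y))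
    (mV : ∀ Y, Measurable (V Y)) (mQ : ∀ Y b b', Measurable fun φ => Q Y φ b b') :
    ‖P.ofMeasPotentials V Q μ hV hQ mV mQ‖ ≤ μ := by
  rw [Submodule.coe_norm]; exact P.norm_ofPotentials_le V Q hμ hV hQ

/-! ## §3 Measurability of the potential value in the field argument — the weak-measurability clause of the exp-linear structure -/

/-- [folklore] **The potential value `φ ↦ 𝐕(Y, φ)` of a measurable table is measurable** (finite sums and products of measurable
entries and measurable bond variables). -/
theorem measurable_potM (h : B13HistM P) (Y : C.Dom) : Measurable fun φ => P.potM h Y φ := by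
  obtain ⟨hV, hQ⟩ := (P.mem_measTables.1 h.2)
  have hsum : Measurable fun φ => ∑ b, ∑ b', P.Qker h.1 Y φ b b' * P.Bv Y φ b * P.Bv Y φ b' := by
    refine Finset.measurable_sum _ fun b _ => Finset.measurable_sum _ fun b' _ => ?_
    exact ((hQ Y b b').mul (P.measurable_Bv' Y b)).mul (P.measurable_Bv' Y b')
  have e : (fun φ => P.potM h Y φ) =
      (fun φ => (1 / 2 : ℂ) * ∑ b, ∑ b', P.Qker h.1 Y φ b b' * P.Bv Y φ b * P.Bv Y φ b') + fun φ => P.Vpp h.1 Y φ :=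
    funext fun φ => rfl
  rw [e]
  exact (hsum.const_mul _).add (hV Y)

/-- [folklore] **The weak-measurability clause**: along a measurable field map `B : α → Arg Y`, `a ↦ potCLMM Y (B a) h` is
a.e.-strongly measurable for EVERY measurable table `h` and every measure. -/
theorem aestronglyMeasurable_potCLMM_comp {α : Type*} [MeasurableSpace α] (μ : Measure α) (Y : C.Dom) {B : α → P.Arg Y}
    (hB : Measurable B) (h : B13HistM P) : AEStronglyMeasurable (fun a => P.potCLMM Y (B a) h) μ := by
  have hm : Measurable fun a => P.potM h Y (B a) := (P.measurable_potM h Y).comp hB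
  simpa only [potCLMM_apply] using hm.aestronglyMeasurable

/-- [folklore] The same for the functionals `Λ(a) = Σ_{Y ∈ D} τ(Y) • potCLMM Y (B_Y a)` of the exp-linear structure (finite sums of
the read-outs with fixed complex weights): `a ↦ Λ(a) h` is a.e.-strongly measurable for every `h`. -/
theorem aestronglyMeasurable_sum_smul_potCLMM {α : Type*} [MeasurableSpace α] (μ : Measure α) (D : Finset C.Dom)
    (τ : C.Dom → ℂ) {B : (Y : C.Dom) → α → P.Arg Y} (hB : ∀ Y, Measurable (B Y)) (h : B13HistM P) :
    AEStronglyMeasurable (fun a => (∑ Y ∈ D, τ Y • P.potCLMM Y (B Y a)) h) μ := by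
  have hm : Measurable fun a => ∑ Y ∈ D, τ Y * P.potM h Y (B Y a) :=
    Finset.measurable_sum _ fun Y _ => ((P.measurable_potM h Y).comp (hB Y)).const_mul _
  have heq : (fun a => (∑ Y ∈ D, τ Y • P.potCLMM Y (B Y a)) h) = fun a => ∑ Y ∈ D, τ Y * P.potM h Y (B Y a) := by
    funext a
    simp only [_root_.sum_apply, _root_.smul_apply, potCLMM_apply, smul_eq_mul]
  rw [heq]
  exact hm.aestronglyMeasurable

/-- [folklore] The potential weights are nonnegative. -/
theorem potWt_nonneg (Y : C.Dom) (φ : P.Arg Y) : 0 ≤ P.potWt Y φ := (norm_nonneg _).trans (P.norm_potCLM_le Y φ)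

/-- [folklore] The operator norm of such a functional is bounded by the weighted sum of the potential weights (the a.e. bound
`∃ N, ∀ᵐ a, ‖Λ a‖ ≤ N` of the exp-linear structure follows whenever the weights are bounded along the field map). -/
theorem norm_sum_smul_potCLMM_le (D : Finset C.Dom) (τ : C.Dom → ℂ) (φ : (Y : C.Dom) → P.Arg Y) :
    ‖∑ Y ∈ D, τ Y • P.potCLMM Y (φ Y)‖ ≤ ∑ Y ∈ D, ‖τ Y‖ * P.potWt Y (φ Y) := by
  refine ContinuousLinearMap.opNorm_le_bound _
    (Finset.sum_nonneg fun Y _ => mul_nonneg (norm_nonneg _) (P.potWt_nonneg Y (φ Y))) fun h => ?_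
  rw [_root_.sum_apply, Finset.sum_mul]
  refine (norm_sum_le _ _).trans (Finset.sum_le_sum fun Y _ => ?_)
  rw [_root_.smul_apply, smul_eq_mul, norm_mul]
  calc ‖τ Y‖ * ‖P.potCLMM Y (φ Y) h‖ ≤ ‖τ Y‖ * (P.potWt Y (φ Y) * ‖h‖) :=
        mul_le_mul_of_nonneg_left (((P.potCLMM Y (φ Y)).le_opNorm h).trans
          (mul_le_mul_of_nonneg_right (P.norm_potCLMM_le Y (φ Y)) (norm_nonneg _))) (norm_nonneg _)
    _ = ‖τ Y‖ * P.potWt Y (φ Y) * ‖h‖ := by ring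

end MeasPotFrame

end Summit.QuantumFields.BalabanUV.T4Continuum.B13HistMeasurable

end
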